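import Mathlib
import HarnessLib
import Summits.NavierStokesRegularity.NavierStokesRegularity.Theorems.UnthreadedDoorNetFluxOneSidedLawCalculus
import Summits.NavierStokesRegularity.NavierStokesRegularity.Theorems.UnthreadedDoorNetFluxExtremalHeadCore

/-!
# Route `UnthreadedDoor`, crux `PoloidalLiouville` (stmt-NavierStokesRegularity-1222), WALL W1 `stub_scalarLiouville` —
# crux idea «netflux-typei-gap» (ns-idea-14), NF-1a `stub_extremalHeadEMF`: the (Δ) side — SLICE LEMMAS

KEY-NS #164/#166 (director-ns g17): NF-1a is divided per sub-stub; this seat holds conjuncts (ii) joint continuity and (v) the a.e. Danskin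
slope of the extremal head difference `I(t,r) = P(t,x⁺) − P(t,x⁻)` (files `…NF1aDeltaContinuity`, `…NF1aDeltaDanskin`); ARM A holds
(T), (T′), (An1), (An2), (Λ) and (i), (iii), (iv) (`…ExtremalHeadCore`, p-landed, imported here for its shell / radial mean-value / envelope
Lipschitz helpers) and the assembly.  INTERFACE: every (Δ) lemma takes the SLICE LEVEL-LIPSCHITZ property
`∀ x y ∈ S_r(x₀), |g x − g y| ≤ Λ · |f x − f y|` as an explicit hypothesis (the conclusion of (Λ) `levelLipschitz` for `f = T(t)`, `g = P(t)`,
`μ = ⟪v(t,·), · − x₀⟫`) and an abstract `I` with property (i).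

This small file: `radialScale_mem_sphere` (radial scaling `S_r → S_{r'}`), `exists_mem_sphArgmin'` (the spherical minimum is attained),
`eq_of_mem_sphArgmax_of_sliceLevelLip` / `eq_of_mem_sphArgmin_of_sliceLevelLip` (under the slice property `g` takes one value on
`argmax f` / `argmin f`), `sSup_image_sphArgmax_eq_of_sliceLevelLip` / `sInf_image_sphArgmin_eq_of_sliceLevelLip`, and `exists_headDiff_fun`
(the choice-free `I(t,r) := sSup (P t '' argmax) − sInf (P t '' argmin)` has property (i) on the whole window).

WHAT THIS IS NOT: no NS-regularity statement is touched (frozen-time bookkeeping on spheres); helper lemmas for sub-parts of the research stub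
NF-1a, which stays OPEN, as do `PoloidalLiouville` (1222), W1, the rung target and the summit.
`--supports stmt-NavierStokesRegularity-1222 --as helper`.  [folklore]
-/

noncomputable section

-- the summit and its single sub-problem share the name (CONVENTIONS §1)
set_option linter.dupNamespace false

open Set Function Filter Topology InnerProductSpace MeasureTheory
open scoped RealInnerProductSpace NNReal

namespace Summit.NavierStokesRegularity.NavierStokesRegularity.Theorems.PoloidalLiouville.NetFlux.NF1a

open Literature.Analysis Literature.Analysis.FluidPDE

variable {f g : E3 → ℝ} {x₀ : E3}

/-! ### Radial scaling of a point of `S_r` to `S_{r'}` -/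

/-- **Radial scaling**: for `x ∈ S_r(x₀)`, `r > 0`, the unit radial vector `u = r⁻¹(x − x₀)` has `‖u‖ = 1`, `x = x₀ + r u`, and
`x₀ + r' u ∈ S_{r'}(x₀)` for `r' ≥ 0`. [folklore] -/
theorem radialScale_mem_sphere {x : E3} {r r' : ℝ} (hr : 0 < r) (hr' : 0 ≤ r') (hx : x ∈ Metric.sphere x₀ r) :
    ‖r⁻¹ • (x - x₀)‖ = 1 ∧ x = x₀ + r • (r⁻¹ • (x - x₀)) ∧ x₀ + r' • (r⁻¹ • (x - x₀)) ∈ Metric.sphere x₀ r' := by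
  have hxn : ‖x - x₀‖ = r := mem_sphere_iff_norm.1 hx
  have hu : ‖r⁻¹ • (x - x₀)‖ = 1 := by rw [norm_smul, norm_inv, Real.norm_of_nonneg hr.le, hxn, inv_mul_cancel₀ hr.ne']
  refine ⟨hu, ?_, ?_⟩
  · rw [smul_smul, mul_inv_cancel₀ hr.ne', one_smul, add_sub_cancel]
  · rw [mem_sphere_iff_norm, add_sub_cancel_left, norm_smul, hu, mul_one, Real.norm_of_nonneg hr']

/-! ### (Δi)/(Δiv): consequences of the slice level-Lipschitz property -/

/-- **The spherical minimum is attained**: `argmin_{S_r(x₀)} f ≠ ∅` for `r ≥ 0` and `f` continuous on the sphere (the argmax of `−f`).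
[folklore] -/
theorem exists_mem_sphArgmin' {r : ℝ} (hf : ContinuousOn f (Metric.sphere x₀ r)) (hr : 0 ≤ r) :
    (sphArgmin f x₀ r).Nonempty := by
  rw [sphArgmin_eq_sphArgmax_neg]
  exact exists_mem_sphArgmax hf.neg hr

/-- Under the slice property `|g x − g y| ≤ Λ|f x − f y|` on `S_r`, `g` takes ONE value on `argmax_{S_r} f`. [folklore] -/
theorem eq_of_mem_sphArgmax_of_sliceLevelLip {r Λ : ℝ}
    (hΛ : ∀ x ∈ Metric.sphere x₀ r, ∀ y ∈ Metric.sphere x₀ r, |g x - g y| ≤ Λ * |f x - f y|)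
    {x y : E3} (hx : x ∈ sphArgmax f x₀ r) (hy : y ∈ sphArgmax f x₀ r) : g x = g y := by
  have hfe : f x = f y := le_antisymm (hy.2 x hx.1) (hx.2 y hy.1)
  have h := hΛ x hx.1 y hy.1
  rw [hfe, sub_self, abs_zero, mul_zero] at h
  exact eq_of_abs_sub_nonpos h

/-- Under the slice property, `g` takes ONE value on `argmin_{S_r} f`. [folklore] -/
theorem eq_of_mem_sphArgmin_of_sliceLevelLip {r Λ : ℝ}
    (hΛ : ∀ x ∈ Metric.sphere x₀ r, ∀ y ∈ Metric.sphere x₀ r, |g x - g y| ≤ Λ * |f x - f y|)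
    {x y : E3} (hx : x ∈ sphArgmin f x₀ r) (hy : y ∈ sphArgmin f x₀ r) : g x = g y := by
  have hfe : f x = f y := le_antisymm (hx.2 y hy.1) (hy.2 x hx.1)
  have h := hΛ x hx.1 y hy.1
  rw [hfe, sub_self, abs_zero, mul_zero] at h
  exact eq_of_abs_sub_nonpos h

/-- Under the slice property, `sSup (g '' argmax_{S_r} f) = g x` for every maximiser `x`. [folklore] -/
theorem sSup_image_sphArgmax_eq_of_sliceLevelLip {r Λ : ℝ}
    (hΛ : ∀ x ∈ Metric.sphere x₀ r, ∀ y ∈ Metric.sphere x₀ r, |g x - g y| ≤ Λ * |f x - f y|)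
    {x : E3} (hx : x ∈ sphArgmax f x₀ r) : sSup (g '' sphArgmax f x₀ r) = g x := by
  have he : g '' sphArgmax f x₀ r = {g x} := by
    ext c
    simp only [mem_image, mem_singleton_iff]
    constructor
    · rintro ⟨y, hy, rfl⟩
      exact eq_of_mem_sphArgmax_of_sliceLevelLip hΛ hy hx
    · rintro rfl
      exact ⟨x, hx, rfl⟩
  rw [he, csSup_singleton]

/-- Under the slice property, `sInf (g '' argmin_{S_r} f) = g x` for every minimiser `x`. [folklore] -/
theorem sInf_image_sphArgmin_eq_of_sliceLevelLip {r Λ : ℝ}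
    (hΛ : ∀ x ∈ Metric.sphere x₀ r, ∀ y ∈ Metric.sphere x₀ r, |g x - g y| ≤ Λ * |f x - f y|)
    {x : E3} (hx : x ∈ sphArgmin f x₀ r) : sInf (g '' sphArgmin f x₀ r) = g x := by
  have he : g '' sphArgmin f x₀ r = {g x} := by
    ext c
    simp only [mem_image, mem_singleton_iff]
    constructor
    · rintro ⟨y, hy, rfl⟩
      exact eq_of_mem_sphArgmin_of_sliceLevelLip hΛ hy hx
    · rintro rfl
      exact ⟨x, hx, rfl⟩
  rw [he, csInf_singleton]

/-- **A choice-free extremal head difference with property (i) on the whole window**: under the slice property at every `(t,r)`,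
`I(t,r) := sSup (P t '' argmax_{S_r} T(t)) − sInf (P t '' argmin_{S_r} T(t))` equals `P(t,x⁺) − P(t,x⁻)` for EVERY extremiser pair.
[folklore] -/
theorem exists_headDiff_fun (T P : ℝ → E3 → ℝ) (x₀ : E3) (t₀ : ℝ) {Λ : ℝ → ℝ → ℝ}
    (hΛ : ∀ t ∈ Ioo t₀ 0, ∀ r > 0, ∀ x ∈ Metric.sphere x₀ r, ∀ y ∈ Metric.sphere x₀ r,
      |P t x - P t y| ≤ Λ t r * |T t x - T t y|) :
    ∃ I : ℝ → ℝ → ℝ, ∀ t ∈ Ioo t₀ 0, ∀ r > 0, ∀ xp ∈ sphArgmax (T t) x₀ r, ∀ xm ∈ sphArgmin (T t) x₀ r,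
      I t r = P t xp - P t xm := by
  refine ⟨fun t r => sSup (P t '' sphArgmax (T t) x₀ r) - sInf (P t '' sphArgmin (T t) x₀ r), ?_⟩
  intro t ht r hr xp hxp xm hxm
  show sSup (P t '' sphArgmax (T t) x₀ r) - sInf (P t '' sphArgmin (T t) x₀ r) = P t xp - P t xm
  rw [sSup_image_sphArgmax_eq_of_sliceLevelLip (hΛ t ht r hr) hxp, sInf_image_sphArgmin_eq_of_sliceLevelLip (hΛ t ht r hr) hxm]

end Summit.NavierStokesRegularity.NavierStokesRegularity.Theorems.PoloidalLiouville.NetFlux.NF1a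

end
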